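import Mathlib.Analysis.InnerProductSpace.PiL2
import Mathlib.LinearAlgebra.Matrix.PosDef
import Mathlib.Analysis.SpecialFunctions.Pow.Real
import Mathlib.Geometry.Euclidean.Inversion.Basic
import HarnessLib

/-!
# Reflection positivity of the Riesz kernel `‖x − y‖^{-s}` in the unit sphere (inversion
# positivity): the ball kernel `(1 − 2⟨x,y⟩ + ‖x‖²‖y‖²)^{-s/2}` — Neeb–Ólafsson 2014, Prop. 6.2

Topic `Literature/Probability/LatticeModels` (vocabulary of route
`CriticalPhenomena/Ising3DConformalLimit/PositivityBegetsConformality`); ONE named fact (result in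
print, `def … : Prop`, D-0014) requested by `wi-13888`, discharging the `(⇐)` half of the route's
support item `TwoPointSpherePositivity` (`stmt-CriticalPhenomena-4676`) for `n = 3`, `s = 2Δ ≥ 1`,
and recording the printed converse.

K.-H. Neeb, G. Ólafsson, *Reflection positivity and conformal symmetry*, J. Funct. Anal. 266
(2014) 2174–2224 = arXiv:1206.2039 (held, read §6 pp. 23–25 and the introduction p. 4):

* **§6.2 "The ball picture", Proposition 6.2** (second numbered statement of §6; arXiv p. 23):
  *The kernel `R(x, y) := (1 − 2⟨x, y⟩ + ‖x‖²‖y‖²)^{−s/2}` on the open unit ball `𝒟 ⊆ ℝⁿ` is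
  positive definite if and only if `s = 0` or `s ≥ max(0, n − 2)`.* (Proof: a conformal
  involution of `𝕊ⁿ` exchanges the half-space and the ball pictures, reducing to Prop. 6.1:
  `‖x‖^{−s}` is positive definite on the involutive semigroup `(ℝⁿ₊, ♯)` iff `s = 0` or
  `s ≥ max(0, n − 2)`, a Laplace–Fourier/Bochner–Schwartz statement on the light cone;
  Example 6.4: for `n = 1, 2` every `s ≥ 0` works.)
* The identity behind "reflection in the sphere": with `σ̃(x) = x/‖x‖²` the inversion in the unit
  sphere, `‖x‖² ‖σ̃(x) − y‖² = 1 − 2⟨x, y⟩ + ‖x‖²‖y‖²` (displayed in the proof, p. 23), so `R` is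
  the
  pointwise form `‖x_b‖^{−s} ‖x_a − σ̃(x_b)‖^{−s}` of reflection positivity of the Riesz kernel
  `‖x − y‖^{−s}` with respect to the unit sphere (conformal weight `s`); PROVED below
  (`norm_sq_mul_norm_inversion_sub_sq`, `ballKernel_eq_inversion_form`).
* **Theorem 6.7** (arXiv p. 24; intro p. 4): for `s = 0` or `n − 2 ≤ s < n` the delta measure on
  the equator `𝕊^{n−1}` is a reflection positive distribution vector of the complementary series
  representation `π_s` of `O⁺_{1,n+1}(ℝ)` for the compression semigroup of the ball — the
  representation-theoretic statement built on Prop. 6.2 (the extra condition `s < n` is the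
  existence of `π_s`); not needed in pointwise form and not vendored. Frank–Lieb 2010 prove the
  half-space reflection positivity of `‖x‖^{−s}`, `max(0, n−2) ≤ s < n`, by different means.

## Rendering

* "Positive definite kernel on `𝒟`" = every finite matrix `(R(x_a, x_b))_{a,b}`, `x_a ∈ 𝒟`, is
  positive semidefinite (`Matrix.PosSemidef` over `ℝ`; the kernel is real symmetric, so this is
  the same as the complex-coefficient condition of the paper's §1.2).
* The base `1 − 2⟨x, y⟩ + ‖x‖²‖y‖² ≥ (1 − ‖x‖‖y‖)² > 0` on the ball, so the real power
  `Real.rpow` carries no junk there.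
* Scope: `1 ≤ n` and `0 ≤ s` (the paper's parameter range for `‖x‖^{−s}`); both directions of the
  printed "if and only if" are vendored in ONE fact. The route's kernel `(…)^{−Δ}` on the
  punctured ball of `ℝ³` is the case `n = 3`, `s = 2Δ` (`ballKernel_posSemidef_dim3`, PROVED from
  the fact; the puncture only removes admissible configurations).

## References

* K.-H. Neeb, G. Ólafsson, *Reflection positivity and conformal symmetry*, J. Funct. Anal. 266
  (2014) 2174–2224, arXiv:1206.2039: §6.1 Prop. 6.1, §6.2 Prop. 6.2 and Example 6.4, §6.3
  Thm. 6.7; introduction p. 4. [`NeebOlafsson2014`]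
* R. L. Frank, E. H. Lieb, *Inversion positivity and the sharp Hardy–Littlewood–Sobolev
  inequality*, Calc. Var. PDE 39 (2010) 85–99 (half-space reflection positivity of `‖x‖^{−s}`,
  `n − 2 ≤ s < n`, and inversion positivity by conformal invariance). [`FrankLieb2010`]
-/

noncomputable section

open scoped RealInnerProductSpace

namespace Literature.Probability.LatticeModels

/-- The **Neeb–Ólafsson ball kernel** `R_s(x, y) = (1 − 2⟨x, y⟩ + ‖x‖²‖y‖²)^{−s/2}` on `ℝⁿ`
(Neeb–Ólafsson 2014, §6.2): the pull-back to the ball picture of the canonical kernel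
`Q(σx, y)` of the complementary series twisted by the sphere reflection `σ`, i.e. the pointwise
form `‖y‖^{−s}‖x − y/‖y‖²‖^{−s}` of the Riesz kernel reflected in the unit sphere
(`ballKernel_eq_inversion_form`). [cite: NeebOlafsson2014, §6.2 Prop. 6.2 (definition of R)] -/
def ballKernel (n : ℕ) (s : ℝ) (x y : EuclideanSpace ℝ (Fin n)) : ℝ :=
  (1 - 2 * inner ℝ x y + ‖x‖ ^ 2 * ‖y‖ ^ 2) ^ (-s / 2)

/-- Unfolding `ballKernel`. [folklore] -/
theorem ballKernel_apply (n : ℕ) (s : ℝ) (x y : EuclideanSpace ℝ (Fin n)) :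
    ballKernel n s x y = (1 - 2 * inner ℝ x y + ‖x‖ ^ 2 * ‖y‖ ^ 2) ^ (-s / 2) :=
  rfl

/-- **Neeb–Ólafsson 2014, Proposition 6.2 (the ball picture).** For `n ≥ 1` and `s ≥ 0`, the
kernel `R_s(x, y) = (1 − 2⟨x, y⟩ + ‖x‖²‖y‖²)^{−s/2}` on the open unit ball of `ℝⁿ` is positive
definite — every finite matrix `(R_s(x_a, x_b))_{a,b}` with `‖x_a‖ < 1` is positive semidefinite —
**if and only if** `s = 0` or `s ≥ max(0, n − 2)` (for `s ≥ 0`: `s = 0 ∨ n − 2 ≤ s`). This is the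
pointwise form of the reflection positivity of the Riesz kernel `‖x − y‖^{−s}` with respect to the
inversion in the unit sphere `𝕊^{n−1}` (compression semigroup of the ball; Thm. 6.7 for the
complementary series `π_s`, `s < n`), cf. Frank–Lieb 2010. Not proved here (Bochner–Schwartz
theorem for the light cone / Laplace–Fourier representation of `‖x‖^{−s}`, Prop. 6.1, transported
by a conformal involution). [cite: NeebOlafsson2014, Prop. 6.2 (§6.2, arXiv:1206.2039 p. 23)] -/
def neebOlafsson2014_ballKernel_posSemidef_iff : Prop :=
  ∀ (n : ℕ), 1 ≤ n → ∀ (s : ℝ), 0 ≤ s →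
    ((∀ (m : ℕ) (x : Fin m → EuclideanSpace ℝ (Fin n)), (∀ a, ‖x a‖ < 1) →
        (Matrix.of fun a b : Fin m =>
          (1 - 2 * inner ℝ (x a) (x b) + ‖x a‖ ^ 2 * ‖x b‖ ^ 2) ^ (-s / 2)).PosSemidef) ↔
      (s = 0 ∨ (n : ℝ) - 2 ≤ s))

/-! ### The sphere-inversion identity (proved) -/

variable {n : ℕ}

/-- **`‖y‖² ‖x − y/‖y‖²‖² = 1 − 2⟨x, y⟩ + ‖x‖²‖y‖²`** for `y ≠ 0` (Neeb–Ólafsson 2014, proof of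
Prop. 6.2, display p. 23, with the roles of `x, y` as in the route: the inversion
`EuclideanGeometry.inversion 0 1 y = ‖y‖⁻² • y` in the unit sphere).
[cite: NeebOlafsson2014, §6.2 (proof of Prop. 6.2, display)] -/
theorem norm_sq_mul_norm_sub_inversion_sq (x : EuclideanSpace ℝ (Fin n))
    {y : EuclideanSpace ℝ (Fin n)} (hy : y ≠ 0) :
    ‖y‖ ^ 2 * ‖x - EuclideanGeometry.inversion 0 1 y‖ ^ 2 =
      1 - 2 * inner ℝ x y + ‖x‖ ^ 2 * ‖y‖ ^ 2 := by
  have hy' : ‖y‖ ≠ 0 := norm_ne_zero_iff.2 hy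
  have hinv : EuclideanGeometry.inversion 0 1 y = (‖y‖ ^ 2)⁻¹ • y := by
    rw [EuclideanGeometry.inversion, dist_zero_right, vsub_eq_sub, sub_zero, vadd_eq_add, add_zero,
      div_pow, one_pow, one_div]
  have hr : 0 ≤ (‖y‖ ^ 2)⁻¹ := inv_nonneg.2 (sq_nonneg _)
  rw [hinv, norm_sub_sq_real, inner_smul_right, norm_smul, Real.norm_eq_abs, abs_of_nonneg hr]
  field_simp
  ring

/-- **The ball kernel is the Riesz kernel reflected in the unit sphere**: for `y ≠ 0` in `ℝⁿ` and
`x` with `‖x‖‖y‖ < 1` (e.g. both in the open unit ball),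
`‖y‖^{−s} · ‖x − y/‖y‖²‖^{−s} = (1 − 2⟨x, y⟩ + ‖x‖²‖y‖²)^{−s/2}` (Neeb–Ólafsson 2014, §6.2;
the matrix of `wi-13888`). PROVED from `norm_sq_mul_norm_sub_inversion_sq`.
[cite: NeebOlafsson2014, §6.2 (proof of Prop. 6.2)] -/
theorem ballKernel_eq_inversion_form (s : ℝ) (x : EuclideanSpace ℝ (Fin n))
    {y : EuclideanSpace ℝ (Fin n)} (hy : y ≠ 0) :
    ‖y‖ ^ (-s) * ‖x - EuclideanGeometry.inversion 0 1 y‖ ^ (-s) = ballKernel n s x y := by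
  rw [ballKernel, ← norm_sq_mul_norm_sub_inversion_sq x hy,
    ← Real.mul_rpow (norm_nonneg _) (norm_nonneg _),
    Real.mul_rpow (sq_nonneg _) (sq_nonneg _), ← Real.rpow_natCast ‖y‖ 2,
    ← Real.rpow_natCast ‖x - _‖ 2, ← Real.rpow_mul (norm_nonneg _),
    ← Real.rpow_mul (norm_nonneg _), Real.mul_rpow (norm_nonneg _) (norm_nonneg _)]
  norm_num
  ring_nf

/-- The base of the kernel is positive on the ball: `1 − 2⟨x, y⟩ + ‖x‖²‖y‖² ≥ (1 − ‖x‖‖y‖)² > 0`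
when `‖x‖‖y‖ < 1` (so `Real.rpow` carries no junk in the fact). [folklore] -/
theorem ballKernel_base_pos {x y : EuclideanSpace ℝ (Fin n)} (h : ‖x‖ * ‖y‖ < 1) :
    0 < 1 - 2 * inner ℝ x y + ‖x‖ ^ 2 * ‖y‖ ^ 2 := by
  have hcs : inner ℝ x y ≤ ‖x‖ * ‖y‖ := real_inner_le_norm x y
  nlinarith [mul_nonneg (norm_nonneg x) (norm_nonneg y)]

/-! ### The route's instance: `n = 3`, `s = 2Δ` -/

/-- **Sphere-reflection positivity in `ℝ³` for `Δ ≥ 1/2`** (the `(⇐)` half of route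
`PositivityBegetsConformality`'s `TwoPointSpherePositivity`): for `1/2 ≤ Δ` and finitely many
points `x_a` of the open unit ball of `ℝ³`, the matrix
`((1 − 2⟨x_a, x_b⟩ + ‖x_a‖²‖x_b‖²)^{−Δ})_{a,b}` is positive semidefinite. PROVED from
Neeb–Ólafsson's Prop. 6.2 with `n = 3`, `s = 2Δ ≥ 1 = n − 2`.
[cite: NeebOlafsson2014, Prop. 6.2 (n = 3, s = 2Δ)] -/
theorem ballKernel_posSemidef_dim3 (h : neebOlafsson2014_ballKernel_posSemidef_iff) {Δ : ℝ}
    (hΔ : 1 / 2 ≤ Δ) (m : ℕ) (x : Fin m → EuclideanSpace ℝ (Fin 3)) (hx : ∀ a, ‖x a‖ < 1) :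
    (Matrix.of fun a b : Fin m =>
      (1 - 2 * inner ℝ (x a) (x b) + ‖x a‖ ^ 2 * ‖x b‖ ^ 2) ^ (-Δ)).PosSemidef := by
  have h3 := (h 3 (by norm_num) (2 * Δ) (by linarith)).2 (Or.inr (by push_cast; linarith)) m x hx
  have e : -(2 * Δ) / 2 = -Δ := by ring
  simpa only [e] using h3

end Literature.Probability.LatticeModels

end
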